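import Literature.MathematicalPhysics.QuantumLattice.AnisotropicHeisenbergNeelOrderPlanarKernel
import HarnessLib

/-!
# Néel order of the layered spin-`S` Heisenberg antiferromagnet for every `S ≥ 1` and every
# interlayer ratio `0 < r ≤ 1`, unconditionally — averaging the interlayer numerator

Topic `MathematicalPhysics/QuantumLattice`; sequel of `AnisotropicHeisenbergNeelOrderPlanarKernel.lean`
for Kennedy–Lieb–Shastry's layered model [KLS1988JSP] eq. (5), `K = (1, 1, r)`, with the in-plane
multipliers `(t, μ) = (0, (-½, -½, 0))`. The previous file bounded the interlayer numerator
pointwise, `r(1 + cos p₃) ≤ 2r`, which costs a slope `0.2457·r` in `W̄(r)` and stops the spin-1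
statement at `r ≤ 2/3`. Here the `p₃`-integral is done FIRST (Tonelli on `[-π,π]³ = [-π,π]² × [-π,π]`,
`measurePreserving_piFinSuccAbove`), with the elementary mean inequality
`√A ≤ (A + λ²)/(2λ)`, `λ² = 2 + 2x + r` (`A = λ² + r cos p₃`): since `∫cos p₃ dp₃ = 0`,

* `lintegral_heisAnisoKlsIntegrand_planar_fiber_le` — for every in-plane momentum with `cos p₁ < 1`,
  `∫_{-π}^{π} G^{(1,1,r)}_{0,(-½,-½,0)}(p₁,p₂,p₃) dp₃ ≤ 2π · x₊[(2 + 2x + r)/(2 - 2x)]^{1/2}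
  = 2π · G^{(1,1,r/2)}_{0,(-½,-½,0)}(p₁,p₂,0)` — i.e. the interlayer coupling enters the
  two-dimensional majorant with HALF weight;
* `heisAnisoKlsIntegral_planar_le_half` —
  **`𝓘^{(1,1,r)}_{0,(-½,-½,0)} ≤ W̄(r/2) = 15√2/64 + 1/π + (r/2)(1/8 + 3823/(10080π))`**
  (`= 0.64977 + 0.12287 r`), from the previous file's pointwise comparison with the tree's certified
  two-dimensional integrals (`heisAnisoKlsIntegrand_planar_le` at `K = (1,1,r/2)`, `p₃ = 0`);
* **`layeredHeis_neelOrderParameter_ge_spinOne`** — for `0 < r ≤ 1` and every spin `S = n/2 ≥ 1`,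
  along the even tori `(ℤ/2kℤ)³`: `liminf |Λ|⁻² Σ_{x,y}(-1)^{x+y}⟨𝐒_x·𝐒_y⟩_{GS} ≥ S(S - 0.7959 - 0.1505r)`;
* **`layeredHeis_neelLRO_spinOne_all`** — **Néel long-range order in the ground state of the layered
  antiferromagnet for EVERY spin `S ≥ 1` and EVERY interlayer ratio `0 < r ≤ 1`** (floor
  `≥ S(S - 0.9464) > 0`; the spin-1 floor is `≥ 1/20` uniformly in `r`), completing
  `layeredHeis_neelLRO_spinOne` (`r ≤ 2/3`) and `layeredHeis_neelLRO_threeHalves`;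
* thermal twins `layeredHeis_thermalNeelOrderParameter_ge_spinOne`,
  **`layeredHeis_neelLRO_thermal_spinOne_all`**: Néel order of the layered spin-`S ≥ 1`
  antiferromagnet at every inverse temperature `β` with
  `2β·S(S - 0.9464) > 2log(2S+1)/(2+r) + 3(3 + log(1/r))` — an explicit `1/log(J∥/J⊥)`
  Néel-temperature floor for all physical spins `S ≥ 1` (the `S = ½` layered case remains
  [KLS1988JSP]'s numerical regime `r ≥ 0.16`, certificate form `layeredHeis_neelLRO_of_certificate`).

No named fact is introduced; nothing numerical beyond the tree's certified `I(2)`-bounds, rational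
arithmetic and decimal brackets of `√2`, `√6`, `π`.

## References

* [KLS1988JSP] T. Kennedy, E. H. Lieb, B. S. Shastry, J. Stat. Phys. 53 (1988) 1019–1030, §3,
  eqs. (5)–(9), p. 1020, p. 1023.
* [KLS1988PRL] T. Kennedy, E. H. Lieb, B. S. Shastry, Phys. Rev. Lett. 61 (1988) 2582–2584,
  eq. (8), `I(2) = 0.65`.
* [DLS1978] F. J. Dyson, E. H. Lieb, B. Simon, J. Stat. Phys. 18 (1978) 335–383, Thms. 6.1, 6.2.
-/

noncomputable section

open MeasureTheory Set Filter Topology Finset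
open scoped ENNReal
open Literature.MathematicalPhysics.QuantumLattice Literature.Probability.LatticeModels
  Literature.MathematicalPhysics.QuantumFieldTheory.Balaban1983to89.Beta

namespace Literature.MathematicalPhysics.QuantumLattice

/-! ### Measurability and coordinates -/

section Prelim

/-- The two-sum-rule integrand is measurable. [cite: KLS1988JSP, eqs. (6)-(9)] -/
theorem measurable_heisAnisoKlsIntegrand {d : ℕ} (K : Fin d → ℝ) (t : ℝ) (μ : Fin d → ℝ) :
    Measurable (heisAnisoKlsIntegrand K t μ) := by
  unfold heisAnisoKlsIntegrand NVectorAniso.anisoDispersion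
  refine Measurable.mul ?_ (Real.continuous_sqrt.measurable.comp ?_)
  · exact (measurable_const.sub (Finset.measurable_sum _ fun i _ =>
      (Real.measurable_cos.comp (measurable_pi_apply i)).const_mul _)).max measurable_const
  · exact (Finset.measurable_sum _ fun i _ =>
      (measurable_const.add (Real.measurable_cos.comp (measurable_pi_apply i))).const_mul _).div
      (Finset.measurable_sum _ fun i _ =>
        (measurable_const.sub (Real.measurable_cos.comp (measurable_pi_apply i))).const_mul _)

/-- A momentum of `[-π,π]³` listed by its coordinates. [folklore] -/
private theorem vec3_eta (p : Fin 3 → ℝ) : ![p 0, p 1, p 2] = p := by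
  funext j
  fin_cases j <;> rfl

/-- The coordinate map `(θ, q) ↦ (q₁, q₂, θ)` is measurable. [folklore] -/
private theorem measurable_vec3_of_prod :
    Measurable fun z : ℝ × (Fin 2 → ℝ) => (![z.2 0, z.2 1, z.1] : Fin 3 → ℝ) := by
  refine measurable_pi_iff.2 fun j => ?_
  fin_cases j
  · show Measurable fun z : ℝ × (Fin 2 → ℝ) => z.2 0
    exact (measurable_pi_apply 0).comp measurable_snd
  · show Measurable fun z : ℝ × (Fin 2 → ℝ) => z.2 1
    exact (measurable_pi_apply 1).comp measurable_snd
  · show Measurable fun z : ℝ × (Fin 2 → ℝ) => z.1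
    exact measurable_fst

end Prelim

/-! ### Averaging the interlayer numerator along a fibre -/

section Fiber

variable {r : ℝ}

/-- **The mean inequality along the interlayer direction.** For `r > 0`, in-plane momenta with
`cos q₁ < 1`, `x = ½(cos q₁ + cos q₂)`, `λ² = 2 + 2x + r`, and every `θ`:
`G^{(1,1,r)}_{0,(-½,-½,0)}(q₁,q₂,θ) ≤ G^{(1,1,r/2)}_{0,(-½,-½,0)}(q₁,q₂,0) · (1 + r cos θ/(2λ²))`
— drop `r(1 - cos θ) ≥ 0` downstairs, then `√A ≤ (A + λ²)/(2λ)` with `A = λ² + r cos θ`; the value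
at `p₃ = 0` of the half-coupling integrand is `x₊ λ/√(2 - 2x)`. [cite: KLS1988JSP, eqs. (6)-(9)] -/
theorem heisAnisoKlsIntegrand_planar_fiber_le (hr : 0 < r) {q : Fin 2 → ℝ}
    (hq : Real.cos (q 0) < 1) (θ : ℝ) :
    heisAnisoKlsIntegrand ![(1 : ℝ), 1, r] 0 ![-(1 / 2 : ℝ), -(1 / 2), 0] ![q 0, q 1, θ] ≤
      heisAnisoKlsIntegrand ![(1 : ℝ), 1, r / 2] 0 ![-(1 / 2 : ℝ), -(1 / 2), 0] ![q 0, q 1, 0] *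
        (1 + r * Real.cos θ / (2 * (2 + (Real.cos (q 0) + Real.cos (q 1)) + r))) := by
  rw [heisAnisoKlsIntegrand_planar_eq, heisAnisoKlsIntegrand_planar_eq]
  simp only [Matrix.cons_val_zero, Matrix.cons_val_one, Matrix.cons_val, Real.cos_zero]
  set c₀ := Real.cos (q 0) with hc₀
  set c₁ := Real.cos (q 1) with hc₁
  set c := Real.cos θ with hc
  set u : ℝ := c₀ + c₁ with hu
  have hc₁1 : c₁ ≤ 1 := Real.cos_le_one _
  have hc1 : c ≤ 1 := Real.cos_le_one _
  have hc1' : -1 ≤ c := Real.neg_one_le_cos _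
  have hc₀1' : -1 ≤ c₀ := Real.neg_one_le_cos _
  have hc₁1' : -1 ≤ c₁ := Real.neg_one_le_cos _
  have hu2 : u < 2 := by rw [hu]; linarith
  set L : ℝ := 2 + u + r with hL
  have hL0 : 0 < L := by rw [hL, hu]; linarith
  rcases le_or_gt u 0 with hu0 | hu0
  · -- both kernels vanish
    have : max (u / 2) 0 = 0 := max_eq_right (by linarith)
    rw [this, zero_mul, zero_mul, zero_mul]
  · have hum : max (u / 2) 0 = u / 2 := max_eq_left (by linarith)
    rw [hum]
    have hx0 : 0 < u / 2 := by linarith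
    have hB : 2 - u ≤ 2 - u + r * (1 - c) := by nlinarith
    have hB0 : 0 < 2 - u := by linarith
    have hA0 : 0 ≤ 2 + u + r * (1 + c) := by nlinarith
    -- (1) drop the interlayer term downstairs
    have h1 : Real.sqrt ((2 + u + r * (1 + c)) / (2 - u + r * (1 - c))) ≤
        Real.sqrt ((2 + u + r * (1 + c)) / (2 - u)) :=
      Real.sqrt_le_sqrt (div_le_div_of_nonneg_left hA0 hB0 hB)
    -- (2) the mean inequality `√A ≤ (A + L)/(2√L)`, `A = L + r c`
    have hsL : 0 < Real.sqrt L := Real.sqrt_pos.2 hL0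
    have hsLsq : Real.sqrt L * Real.sqrt L = L := Real.mul_self_sqrt hL0.le
    have hAL : 2 + u + r * (1 + c) = L + r * c := by rw [hL]; ring
    have h2 : Real.sqrt (L + r * c) ≤ (L + r * c + L) / (2 * Real.sqrt L) := by
      rw [le_div_iff₀ (by positivity)]
      have hy := Real.sq_sqrt (by linarith : (0 : ℝ) ≤ L + r * c)
      nlinarith [sq_nonneg (Real.sqrt (L + r * c) - Real.sqrt L), Real.sqrt_nonneg (L + r * c)]
    -- (3) the half-coupling integrand at `p₃ = 0`
    have e0 : (2 + u + r / 2 * (1 + 1)) / (2 - u + r / 2 * (1 - 1)) = L / (2 - u) := by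
      rw [hL]; ring_nf
    rw [e0, hAL]
    have e1 : Real.sqrt ((L + r * c) / (2 - u)) = Real.sqrt (L + r * c) / Real.sqrt (2 - u) :=
      Real.sqrt_div (by linarith) _
    have e2 : Real.sqrt (L / (2 - u)) = Real.sqrt L / Real.sqrt (2 - u) := Real.sqrt_div hL0.le _
    have hs2u : 0 < Real.sqrt (2 - u) := Real.sqrt_pos.2 hB0
    rw [hAL] at h1
    calc u / 2 * Real.sqrt ((L + r * c) / (2 - u + r * (1 - c)))
        ≤ u / 2 * Real.sqrt ((L + r * c) / (2 - u)) := mul_le_mul_of_nonneg_left h1 hx0.le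
      _ = u / 2 * Real.sqrt (L + r * c) / Real.sqrt (2 - u) := by rw [e1, mul_div_assoc]
      _ ≤ u / 2 * ((L + r * c + L) / (2 * Real.sqrt L)) / Real.sqrt (2 - u) :=
          div_le_div_of_nonneg_right (mul_le_mul_of_nonneg_left h2 hx0.le) hs2u.le
      _ = u / 2 * Real.sqrt (L / (2 - u)) * (1 + r * c / (2 * L)) := by
          rw [e2]
          field_simp
          nlinarith [hsLsq]

/-- **The fibre integral.** For `r > 0` and in-plane momenta with `cos q₁ < 1`:
`∫_{[-π,π]} G^{(1,1,r)}_{0,(-½,-½,0)}(q₁,q₂,θ) dθ ≤ 2π · G^{(1,1,r/2)}_{0,(-½,-½,0)}(q₁,q₂,0)`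
(as Lebesgue integrals), because `∫_{-π}^{π}(1 + r cos θ/(2λ²)) dθ = 2π`.
[cite: KLS1988JSP, eqs. (6)-(9)] -/
theorem lintegral_heisAnisoKlsIntegrand_planar_fiber_le (hr : 0 < r) {q : Fin 2 → ℝ}
    (hq : Real.cos (q 0) < 1) :
    ∫⁻ θ in Icc (-Real.pi) Real.pi,
        ENNReal.ofReal (heisAnisoKlsIntegrand ![(1 : ℝ), 1, r] 0 ![-(1 / 2 : ℝ), -(1 / 2), 0] ![q 0, q 1, θ]) ≤
      ENNReal.ofReal (2 * Real.pi) *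
        ENNReal.ofReal (heisAnisoKlsIntegrand ![(1 : ℝ), 1, r / 2] 0 ![-(1 / 2 : ℝ), -(1 / 2), 0] ![q 0, q 1, 0]) := by
  set M : ℝ := heisAnisoKlsIntegrand ![(1 : ℝ), 1, r / 2] 0 ![-(1 / 2 : ℝ), -(1 / 2), 0] ![q 0, q 1, 0]
    with hM
  have hM0 : 0 ≤ M := heisAnisoKlsIntegrand_nonneg _ _ _ _
  set L : ℝ := 2 + (Real.cos (q 0) + Real.cos (q 1)) + r with hL
  have hL0 : 0 < L := by
    rw [hL]; linarith [Real.neg_one_le_cos (q 0), Real.neg_one_le_cos (q 1)]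
  set h : ℝ → ℝ := fun θ => M * (1 + r * Real.cos θ / (2 * L)) with hh
  have hh0 : ∀ θ, 0 ≤ h θ := by
    intro θ
    refine mul_nonneg hM0 ?_
    have h2L : 0 < 2 * L := by positivity
    have : -1 ≤ r * Real.cos θ / (2 * L) := by
      rw [le_div_iff₀ h2L, hL]
      nlinarith [Real.neg_one_le_cos θ, Real.neg_one_le_cos (q 0), Real.neg_one_le_cos (q 1),
        Real.cos_le_one (q 0)]
    linarith
  have hcont : Continuous h := by
    rw [hh]
    exact continuous_const.mul (continuous_const.add
      ((continuous_const.mul Real.continuous_cos).div_const _))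
  have hπ : -Real.pi ≤ Real.pi := by linarith [Real.pi_pos]
  -- pointwise, then the fibre integral of the majorant in closed form
  calc ∫⁻ θ in Icc (-Real.pi) Real.pi,
        ENNReal.ofReal (heisAnisoKlsIntegrand ![(1 : ℝ), 1, r] 0 ![-(1 / 2 : ℝ), -(1 / 2), 0] ![q 0, q 1, θ])
      ≤ ∫⁻ θ in Icc (-Real.pi) Real.pi, ENNReal.ofReal (h θ) :=
        lintegral_mono fun θ => ENNReal.ofReal_le_ofReal
          (heisAnisoKlsIntegrand_planar_fiber_le hr hq θ)
    _ = ENNReal.ofReal (∫ θ in Icc (-Real.pi) Real.pi, h θ) :=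
        (ofReal_integral_eq_lintegral_ofReal (hcont.integrableOn_Icc)
          (Eventually.of_forall hh0)).symm
    _ = ENNReal.ofReal (2 * Real.pi * M) := by
        congr 1
        rw [integral_Icc_eq_integral_Ioc, ← intervalIntegral.integral_of_le hπ, hh]
        rw [intervalIntegral.integral_const_mul]
        have hint : ∫ θ in (-Real.pi)..Real.pi, (1 + r * Real.cos θ / (2 * L)) = 2 * Real.pi := by
          have ef : (fun θ => 1 + r * Real.cos θ / (2 * L)) =
              fun θ => (1 : ℝ) + r / (2 * L) * Real.cos θ := by
            funext θ; ring
          rw [ef, intervalIntegral.integral_add intervalIntegrable_const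
            ((Real.continuous_cos.const_mul _).intervalIntegrable _ _),
            intervalIntegral.integral_const, intervalIntegral.integral_const_mul, integral_cos,
            Real.sin_neg, Real.sin_pi]
          simp only [smul_eq_mul, mul_one, neg_zero, sub_zero, mul_zero, add_zero]
          ring
        rw [hint]
        ring
    _ = ENNReal.ofReal (2 * Real.pi) * ENNReal.ofReal M := by
        rw [ENNReal.ofReal_mul (by positivity)]

end Fiber

/-! ### The integral bound with the halved interlayer slope -/

section Integral

variable {r : ℝ}

/-- Local copy of the measurability of the anisotropic XY integrand (private upstream).
[cite: KLS1988PRL, eq. (8)] -/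
private theorem measurable_anisoKlsIntegrand'' {d : ℕ} (K : Fin d → ℝ) :
    Measurable (anisoKlsIntegrand K) := by
  unfold anisoKlsIntegrand anisoCosSum NVectorAniso.anisoDispersion
  refine Measurable.mul ?_ (Real.continuous_sqrt.measurable.comp ?_)
  · exact (Finset.measurable_sum _ fun i _ =>
      (Real.measurable_cos.comp (measurable_pi_apply i)).const_mul _).max measurable_const
  · exact measurable_const.div (measurable_const.mul (Finset.measurable_sum _ fun i _ =>
      (measurable_const.sub (Real.measurable_cos.comp (measurable_pi_apply i))).const_mul _))

/-- **`𝓘^{(1,1,r)}_{0,(-½,-½,0)} ≤ W̄(r/2) = 15√2/64 + 1/π + (r/2)(1/8 + 3823/(10080π))`**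
(`0 < r`): Tonelli on `[-π,π]³ ≅ [-π,π] × [-π,π]²` at the interlayer coordinate
(`measurePreserving_piFinSuccAbove`), the fibre bound
`lintegral_heisAnisoKlsIntegrand_planar_fiber_le`, then the previous file's pointwise comparison at
`K = (1, 1, r/2)`, `p₃ = 0` with the tree's certified two-dimensional integrals.
[cite: KLS1988JSP, eqs. (6)-(9)] [cite: KLS1988PRL, after eq. (8)] -/
theorem heisAnisoKlsIntegral_planar_le_half (hr : 0 < r) :
    heisAnisoKlsIntegral ![(1 : ℝ), 1, r] 0 ![-(1 / 2 : ℝ), -(1 / 2), 0] ≤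
      15 * Real.sqrt 2 / 64 + 1 / Real.pi + r / 2 * (1 / 8 + 3823 / (10080 * Real.pi)) := by
  set K : Fin 3 → ℝ := ![(1 : ℝ), 1, r] with hKdef
  set μ : Fin 3 → ℝ := ![-(1 / 2 : ℝ), -(1 / 2), 0] with hμdef
  have hK : ∀ i, 0 < K i := by
    intro i; fin_cases i
    · show (0 : ℝ) < 1; norm_num
    · show (0 : ℝ) < 1; norm_num
    · show (0 : ℝ) < r; exact hr
  have hπ : 0 < Real.pi := Real.pi_pos
  have hs2 : 0 < Real.sqrt 2 := Real.sqrt_pos.2 (by norm_num)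
  have h2π3 : (0 : ℝ) < (2 * Real.pi) ^ 3 := by positivity
  set G : (Fin 3 → ℝ) → ℝ := heisAnisoKlsIntegrand K 0 μ with hGdef
  have hGm : Measurable G := measurable_heisAnisoKlsIntegrand K 0 μ
  have hGi := integrableOn_heisAnisoKlsIntegrand (le_refl 3) hK 0 μ
  have hbox : ∀ m : ℕ, brillouin m = Set.pi univ (fun _ : Fin m => Icc (-Real.pi) Real.pi) :=
    fun m => rfl
  -- (1) Bochner integral = Lebesgue integral
  have hint : ∫ p in brillouin 3, G p = (∫⁻ p in brillouin 3, ENNReal.ofReal (G p)).toReal :=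
    integral_eq_lintegral_of_nonneg_ae
      (Eventually.of_forall fun p => heisAnisoKlsIntegrand_nonneg K 0 μ p) hGi.aestronglyMeasurable
  -- (2) the box measure as a product, and Tonelli at the coordinate `2`
  set μ₀ : Measure ℝ := volume.restrict (Icc (-Real.pi) Real.pi) with hμ₀
  have hpi : ∀ m : ℕ, (volume : Measure (Fin m → ℝ)).restrict (brillouin m) =
      Measure.pi fun _ : Fin m => μ₀ := fun m => by
    rw [hbox m, volume_pi, Measure.restrict_pi_pi]
  set e := MeasurableEquiv.piFinSuccAbove (fun _ : Fin 3 => ℝ) 2 with he_def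
  have he := measurePreserving_piFinSuccAbove (n := 2) (α := fun _ => ℝ) (fun _ => μ₀) 2
  set g : ℝ × (Fin 2 → ℝ) → ℝ≥0∞ := fun z => ENNReal.ofReal (G ![z.2 0, z.2 1, z.1]) with hgdef
  have hgm : Measurable g := (ENNReal.measurable_ofReal.comp hGm).comp measurable_vec3_of_prod
  have hcomp : ∀ p : Fin 3 → ℝ, ENNReal.ofReal (G p) = g (e p) := fun p =>
    congrArg (fun v => ENNReal.ofReal (G v)) (vec3_eta p).symm
  have hT : ∫⁻ p in brillouin 3, ENNReal.ofReal (G p) =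
      ∫⁻ q, ∫⁻ θ, g (θ, q) ∂μ₀ ∂(Measure.pi fun _ : Fin 2 => μ₀) := by
    rw [hpi 3]
    calc ∫⁻ p, ENNReal.ofReal (G p) ∂(Measure.pi fun _ : Fin 3 => μ₀)
        = ∫⁻ p, g (e p) ∂(Measure.pi fun _ : Fin 3 => μ₀) := lintegral_congr fun p => hcomp p
      _ = ∫⁻ z, g z ∂(μ₀.prod (Measure.pi fun _ : Fin 2 => μ₀)) :=
          he.lintegral_comp_emb e.measurableEmbedding g
      _ = ∫⁻ q, ∫⁻ θ, g (θ, q) ∂μ₀ ∂(Measure.pi fun _ : Fin 2 => μ₀) :=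
          lintegral_prod_symm g hgm.aemeasurable
  -- (3) the fibre bound, almost everywhere in the in-plane momenta
  set M : (Fin 2 → ℝ) → ℝ := fun q =>
    heisAnisoKlsIntegrand ![(1 : ℝ), 1, r / 2] 0 ![-(1 / 2 : ℝ), -(1 / 2), 0] ![q 0, q 1, 0] with hMdef
  set F : (Fin 2 → ℝ) → ℝ≥0∞ := fun q => ENNReal.ofReal (klsIntegrand 2 q) with hFdef
  set A : (Fin 2 → ℝ) → ℝ≥0∞ := fun q => ENNReal.ofReal (anisoKlsIntegrand ![(1 : ℝ), 1] q)
    with hAdef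
  have hFm : Measurable F := ENNReal.measurable_ofReal.comp (measurable_klsIntegrand 2)
  have hAm : Measurable A := ENNReal.measurable_ofReal.comp (measurable_anisoKlsIntegrand'' _)
  set c : ℝ := r / 2 / (2 * Real.sqrt 2) with hc
  have hc0 : 0 ≤ c := by positivity
  have hae : ∀ᵐ q ∂(Measure.pi fun _ : Fin 2 => μ₀),
      ∫⁻ θ, g (θ, q) ∂μ₀ ≤ ENNReal.ofReal (2 * Real.pi) * (F q + ENNReal.ofReal c * A q) := by
    rw [← hpi 2]
    filter_upwards [ae_restrict_of_ae (ae_forall_cos_apply_lt_one 2)] with q hq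
    have hq0 : Real.cos (q 0) < 1 := hq 0
    have hfib := lintegral_heisAnisoKlsIntegrand_planar_fiber_le hr (q := q) hq0
    -- the half-coupling integrand at `p₃ = 0` against the 2D integrands
    have hpt := heisAnisoKlsIntegrand_planar_le (r := r / 2) (by positivity) (p := ![q 0, q 1, 0])
      (by simpa using hq0)
    have hsucc : (fun j : Fin 2 => (![q 0, q 1, (0 : ℝ)] : Fin 3 → ℝ) ((2 : Fin 3).succAbove j)) = q := by
      funext j
      fin_cases j <;> rfl
    rw [hsucc] at hpt
    have hpt' : ENNReal.ofReal (M q) ≤ F q + ENNReal.ofReal c * A q := by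
      rw [hFdef, hAdef]
      simp only
      rw [← ENNReal.ofReal_mul hc0, ← ENNReal.ofReal_add (klsIntegrand_nonneg _ _)
        (mul_nonneg hc0 (anisoKlsIntegrand_nonneg _ _))]
      exact ENNReal.ofReal_le_ofReal hpt
    calc ∫⁻ θ, g (θ, q) ∂μ₀
        = ∫⁻ θ in Icc (-Real.pi) Real.pi,
            ENNReal.ofReal (heisAnisoKlsIntegrand ![(1 : ℝ), 1, r] 0 ![-(1 / 2 : ℝ), -(1 / 2), 0]
              ![q 0, q 1, θ]) := rfl
      _ ≤ ENNReal.ofReal (2 * Real.pi) * ENNReal.ofReal (M q) := hfib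
      _ ≤ ENNReal.ofReal (2 * Real.pi) * (F q + ENNReal.ofReal c * A q) :=
          mul_le_mul_right hpt' _
  -- (4) integrate the in-plane momenta with the certified two-dimensional values
  set X₁ : ℝ := 15 * Real.sqrt 2 * Real.pi ^ 2 / 16 + 4 * Real.pi with hX₁
  set X₂ : ℝ := Real.sqrt 2 * Real.pi ^ 2 + 4 * Real.sqrt 2 * (3823 / 5040) * Real.pi with hX₂
  have hX₁0 : 0 ≤ X₁ := by positivity
  have hX₂0 : 0 ≤ X₂ := by positivity
  have hF : ∫⁻ q, F q ∂(Measure.pi fun _ : Fin 2 => μ₀) ≤ ENNReal.ofReal X₁ := by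
    rw [← hpi 2, hbox 2]
    exact lintegral_klsIntegrand_two_le_sharp
  have hA : ∫⁻ q, A q ∂(Measure.pi fun _ : Fin 2 => μ₀) ≤ ENNReal.ofReal X₂ := by
    rw [← hpi 2, hbox 2]
    exact lintegral_anisoKlsIntegrand_two_le
  have hL : ∫⁻ p in brillouin 3, ENNReal.ofReal (G p) ≤
      ENNReal.ofReal (2 * Real.pi * (X₁ + c * X₂)) := by
    rw [hT]
    calc ∫⁻ q, ∫⁻ θ, g (θ, q) ∂μ₀ ∂(Measure.pi fun _ : Fin 2 => μ₀)
        ≤ ∫⁻ q, ENNReal.ofReal (2 * Real.pi) * (F q + ENNReal.ofReal c * A q)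
            ∂(Measure.pi fun _ : Fin 2 => μ₀) := lintegral_mono_ae hae
      _ = ENNReal.ofReal (2 * Real.pi) *
            ((∫⁻ q, F q ∂(Measure.pi fun _ : Fin 2 => μ₀)) +
              ENNReal.ofReal c * ∫⁻ q, A q ∂(Measure.pi fun _ : Fin 2 => μ₀)) := by
          have hsm : Measurable (fun q => F q + ENNReal.ofReal c * A q) := hFm.add (hAm.const_mul _)
          rw [lintegral_const_mul _ hsm, lintegral_add_left hFm, lintegral_const_mul _ hAm]
      _ ≤ ENNReal.ofReal (2 * Real.pi) * (ENNReal.ofReal X₁ + ENNReal.ofReal c * ENNReal.ofReal X₂) :=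
          mul_le_mul_right (add_le_add hF (mul_le_mul_right hA _)) _
      _ = ENNReal.ofReal (2 * Real.pi * (X₁ + c * X₂)) := by
          rw [← ENNReal.ofReal_mul hc0, ← ENNReal.ofReal_add hX₁0 (by positivity),
            ← ENNReal.ofReal_mul (by positivity)]
  have hreal : ∫ p in brillouin 3, G p ≤ 2 * Real.pi * (X₁ + c * X₂) := by
    rw [hint]
    exact ENNReal.toReal_le_of_le_ofReal (by positivity) hL
  -- (5) divide by `(2π)³`
  rw [heisAnisoKlsIntegral, div_le_iff₀ h2π3]
  refine hreal.trans (le_of_eq ?_)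
  rw [hX₁, hX₂, hc]
  have hs2' : Real.sqrt 2 * Real.sqrt 2 = 2 := Real.mul_self_sqrt (by norm_num)
  field_simp
  nlinarith [hs2']

end Integral

/-! ### Néel order for every spin `S ≥ 1`, every `0 < r ≤ 1` -/

section Order

variable {r : ℝ}

/-- Decimal form of the halved slope: `(3/√6)·W̄(r/2) ≤ 0.7959 + 0.1505 r`.
[cite: KLS1988PRL, after eq. (8)] -/
theorem planarBound_half_decimal (hr : 0 ≤ r) :
    3 / Real.sqrt 6 * (15 * Real.sqrt 2 / 64 + 1 / Real.pi + r / 2 * (1 / 8 + 3823 / (10080 * Real.pi))) ≤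
      0.7959 + 0.1505 * r := by
  have h := planarBound_decimal (r := r / 2) (by positivity)
  linarith

/-- **The ground-state floor for every spin `S ≥ 1` and every `0 < r ≤ 1`**: along the even tori
`(ℤ/2kℤ)³`, `liminf |Λ|⁻² Σ_{x,y}(-1)^{x+y}⟨𝐒_x·𝐒_y⟩_{GS} ≥ S(S - 0.7959 - 0.1505r)`.
[cite: KLS1988JSP, eqs. (5)-(9), p. 1020, p. 1023] [cite: KLS1988PRL, after eq. (8)] -/
theorem layeredHeis_neelOrderParameter_ge_spinOne (hr0 : 0 < r) (hr1 : r ≤ 1) {n : ℕ} (hn : 2 ≤ n) :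
    (n : ℝ) / 2 * ((n : ℝ) / 2 - 0.7959 - 0.1505 * r) ≤
      liminf (fun k : ℕ =>
        (∑ x : TorusSite 3 (2 * k + 2), ∑ y : TorusSite 3 (2 * k + 2),
          (-1 : ℝ) ^ (∑ i, (x i).val) * (-1) ^ (∑ i, (y i).val) *
            ∑ α : Fin 3, heisAnisoGroundCorr α (2 * k + 2) n ![(1 : ℝ), 1, r] x y) /
          ((2 * k + 2 : ℕ) : ℝ) ^ (2 * 3)) atTop := by
  set Wb : ℝ := 15 * Real.sqrt 2 / 64 + 1 / Real.pi + r / 2 * (1 / 8 + 3823 / (10080 * Real.pi))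
    with hWb
  have hS : (1 : ℝ) ≤ (n : ℝ) / 2 := by
    have : (2 : ℝ) ≤ n := by exact_mod_cast hn
    linarith
  have hS0 : (0 : ℝ) ≤ (n : ℝ) / 2 := by linarith
  have h6 : 0 < Real.sqrt 6 := Real.sqrt_pos.2 (by norm_num)
  have hs6 : Real.sqrt 6 < 2.45 := by
    rw [Real.sqrt_lt' (by norm_num)]; norm_num
  have hd : 3 / Real.sqrt 6 * Wb ≤ 0.7959 + 0.1505 * r := planarBound_half_decimal hr0.le
  have hWb0 : 0 ≤ Wb := by rw [hWb]; positivity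
  have hWb1 : Wb < 0.8 := by
    -- `(3/√6)·W̄ ≤ 0.9464` and `3/√6 > 1.22`
    have h1 : 3 / Real.sqrt 6 * Wb ≤ 0.9464 := by nlinarith
    have h2 : (1.22 : ℝ) < 3 / Real.sqrt 6 := by
      rw [lt_div_iff₀ h6]; nlinarith
    nlinarith [mul_le_mul_of_nonneg_right h2.le hWb0]
  refine le_of_forall_pos_le_add fun η hη => ?_
  set η' : ℝ := min η (1 / 10) / (3 / Real.sqrt 6 * ((n : ℝ) / 2) + 1) with hη'
  have hden : 0 < 3 / Real.sqrt 6 * ((n : ℝ) / 2) + 1 := by positivity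
  have hη'0 : 0 < η' := by rw [hη']; positivity
  have hη'1 : η' ≤ 1 / 10 := by
    rw [hη', div_le_iff₀ hden]
    have : min η (1 / 10) ≤ 1 / 10 := min_le_right _ _
    nlinarith [this, (by positivity : (0 : ℝ) ≤ 3 / Real.sqrt 6 * ((n : ℝ) / 2))]
  have hW6 : (Wb + η') * Real.sqrt 6 ≤ 4 * ((n : ℝ) / 2) := by nlinarith
  have h := layeredHeis_planar_neelOrderParameter_ge_of_lt hr0 hr1 (by omega) (W := Wb + η')
    (by positivity) hW6 (by linarith [heisAnisoKlsIntegral_planar_le_half hr0])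
  have hcost : 3 / Real.sqrt 6 * ((n : ℝ) / 2) * η' ≤ η := by
    have h1 : 3 / Real.sqrt 6 * ((n : ℝ) / 2) * η' ≤ (3 / Real.sqrt 6 * ((n : ℝ) / 2) + 1) * η' :=
      mul_le_mul_of_nonneg_right (by linarith) hη'0.le
    have h2 : (3 / Real.sqrt 6 * ((n : ℝ) / 2) + 1) * η' = min η (1 / 10) := by
      rw [hη']; field_simp
    linarith [min_le_left η (1 / 10)]
  have e : ((n : ℝ) / 2) ^ 2 - 3 / Real.sqrt 6 * ((n : ℝ) / 2) * (Wb + η') =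
      ((n : ℝ) / 2) ^ 2 - (n : ℝ) / 2 * (3 / Real.sqrt 6 * Wb) - 3 / Real.sqrt 6 * ((n : ℝ) / 2) * η' := by
    ring
  nlinarith [h, e, hcost, mul_le_mul_of_nonneg_left hd hS0]

/-- **Néel long-range order of the layered spin-`S` Heisenberg antiferromagnet in the ground state,
for EVERY spin `S ≥ 1` and EVERY interlayer ratio `0 < r ≤ 1`, unconditionally**: the floor is
`≥ S(S - 0.9464) > 0` for `n = 2S ≥ 2`. This is the layered counterpart of [KLS1988JSP] p. 1020's
"`d = 2`, `S ≥ 1`" obtained from the SAME two-dimensional integral `I(2)` by the in-plane choice of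
multipliers and the average over the interlayer momentum; the spin-½ layered case is the source's
numerical regime `1 ≥ r ≥ 0.16`. [cite: KLS1988JSP, §3, eq. (5), p. 1020]
[cite: KLS1988PRL, after eq. (8)] [cite: DLS1978, Thm. 6.2] -/
theorem layeredHeis_neelLRO_spinOne_all (hr0 : 0 < r) (hr1 : r ≤ 1) {n : ℕ} (hn : 2 ≤ n) :
    0 < (n : ℝ) / 2 * ((n : ℝ) / 2 - 0.9464) ∧
      (n : ℝ) / 2 * ((n : ℝ) / 2 - 0.9464) ≤
        liminf (fun k : ℕ =>
          (∑ x : TorusSite 3 (2 * k + 2), ∑ y : TorusSite 3 (2 * k + 2),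
            (-1 : ℝ) ^ (∑ i, (x i).val) * (-1) ^ (∑ i, (y i).val) *
              ∑ α : Fin 3, heisAnisoGroundCorr α (2 * k + 2) n ![(1 : ℝ), 1, r] x y) /
            ((2 * k + 2 : ℕ) : ℝ) ^ (2 * 3)) atTop := by
  have hS : (1 : ℝ) ≤ (n : ℝ) / 2 := by
    have : (2 : ℝ) ≤ n := by exact_mod_cast hn
    linarith
  have h := layeredHeis_neelOrderParameter_ge_spinOne hr0 hr1 hn
  refine ⟨mul_pos (by linarith) (by linarith), le_trans ?_ h⟩
  have hS0 : (0 : ℝ) ≤ (n : ℝ) / 2 := by linarith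
  nlinarith [mul_le_mul_of_nonneg_left hr1 hS0]

/-- **The spin-1 floor, uniformly in the interlayer ratio**: for `n = 2` and every `0 < r ≤ 1`,
`liminf |Λ|⁻² Σ_{x,y}(-1)^{x+y}⟨𝐒_x·𝐒_y⟩_{GS} ≥ 1/20`. [cite: KLS1988JSP, §3, eq. (5), p. 1020] -/
theorem layeredHeis_neelOrderParameter_ge_spinOne_one_twentieth (hr0 : 0 < r) (hr1 : r ≤ 1) :
    (1 : ℝ) / 20 ≤
      liminf (fun k : ℕ =>
        (∑ x : TorusSite 3 (2 * k + 2), ∑ y : TorusSite 3 (2 * k + 2),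
          (-1 : ℝ) ^ (∑ i, (x i).val) * (-1) ^ (∑ i, (y i).val) *
            ∑ α : Fin 3, heisAnisoGroundCorr α (2 * k + 2) 2 ![(1 : ℝ), 1, r] x y) /
          ((2 * k + 2 : ℕ) : ℝ) ^ (2 * 3)) atTop := by
  have h := layeredHeis_neelOrderParameter_ge_spinOne hr0 hr1 (le_refl 2)
  refine le_trans ?_ h
  norm_num
  nlinarith

end Order

/-! ### Néel order at positive temperature, every spin `S ≥ 1`, every `0 < r ≤ 1` -/

section Thermal

variable {r : ℝ}

/-- **The thermal floor for every spin `S ≥ 1`, every `0 < r ≤ 1`, every `β > 0`**: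
`liminf |Λ|⁻² Σ_{x,y}(-1)^{x+y}⟨𝐒_x·𝐒_y⟩_β ≥
S(S - 0.7959 - 0.1505r) - log(n+1)/((2+r)β) - 3C(r)/(2β)`, `C(r) = klsConstant r`, along the even
tori `(ℤ/(2k+2)ℤ)³`. [cite: KLS1988JSP, p. 1020, eqs. (5)-(9)] [cite: DLS1978, Thms. 6.1, 6.2]
[cite: FILS1978, eq. (4.7)] -/
theorem layeredHeis_thermalNeelOrderParameter_ge_spinOne (hr0 : 0 < r) (hr1 : r ≤ 1) {n : ℕ}
    (hn : 2 ≤ n) {β : ℝ} (hβ : 0 < β) :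
    (n : ℝ) / 2 * ((n : ℝ) / 2 - 0.7959 - 0.1505 * r) - Real.log (n + 1) / ((2 + r) * β) -
        3 * AnisotropicRotator.klsConstant r / (2 * β) ≤
      liminf (fun k : ℕ =>
        (∑ x : TorusSite 3 (2 * k + 2), ∑ y : TorusSite 3 (2 * k + 2),
          (-1 : ℝ) ^ (∑ i, (x i).val) * (-1) ^ (∑ i, (y i).val) *
            ∑ α : Fin 3, gibbsSpinCorr β (heisAnisoTorus (2 * k + 2) n ![(1 : ℝ), 1, r]) α x y) /
          ((2 * k + 2 : ℕ) : ℝ) ^ (2 * 3)) atTop := by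
  set Wb : ℝ := 15 * Real.sqrt 2 / 64 + 1 / Real.pi + r / 2 * (1 / 8 + 3823 / (10080 * Real.pi))
    with hWb
  set C : ℝ := AnisotropicRotator.klsConstant r with hC
  have hS : (1 : ℝ) ≤ (n : ℝ) / 2 := by
    have : (2 : ℝ) ≤ n := by exact_mod_cast hn
    linarith
  have hS0 : (0 : ℝ) ≤ (n : ℝ) / 2 := by linarith
  have h6 : 0 < Real.sqrt 6 := Real.sqrt_pos.2 (by norm_num)
  have hs6 : Real.sqrt 6 < 2.45 := by
    rw [Real.sqrt_lt' (by norm_num)]; norm_num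
  have hd : 3 / Real.sqrt 6 * Wb ≤ 0.7959 + 0.1505 * r := planarBound_half_decimal hr0.le
  have hWb0 : 0 ≤ Wb := by rw [hWb]; positivity
  have hWb1 : Wb < 0.8 := by
    have h1 : 3 / Real.sqrt 6 * Wb ≤ 0.9464 := by nlinarith
    have h2 : (1.22 : ℝ) < 3 / Real.sqrt 6 := by
      rw [lt_div_iff₀ h6]; nlinarith
    nlinarith [mul_le_mul_of_nonneg_right h2.le hWb0]
  refine le_of_forall_pos_le_add fun η hη => ?_
  set η' : ℝ := min (η / 2) (1 / 10) / (3 / Real.sqrt 6 * ((n : ℝ) / 2) + 1) with hη'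
  have hden : 0 < 3 / Real.sqrt 6 * ((n : ℝ) / 2) + 1 := by positivity
  have hη'0 : 0 < η' := by rw [hη']; positivity
  have hη'1 : η' ≤ 1 / 10 := by
    rw [hη', div_le_iff₀ hden]
    have : min (η / 2) (1 / 10) ≤ 1 / 10 := min_le_right _ _
    nlinarith [this, (by positivity : (0 : ℝ) ≤ 3 / Real.sqrt 6 * ((n : ℝ) / 2))]
  have hW6 : (Wb + η') * Real.sqrt 6 ≤ 4 * ((n : ℝ) / 2) := by nlinarith
  have h := layeredHeis_planar_thermalNeelOrderParameter_ge_of_lt hr0 hr1 (by omega) hβ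
    (W := Wb + η') (Tbar := C + β * η / 3) (by positivity) hW6
    (by linarith [heisAnisoKlsIntegral_planar_le_half hr0]) (by rw [hC]; linarith [mul_pos hβ hη])
  have hcost : 3 / Real.sqrt 6 * ((n : ℝ) / 2) * η' ≤ η / 2 := by
    have h1 : 3 / Real.sqrt 6 * ((n : ℝ) / 2) * η' ≤ (3 / Real.sqrt 6 * ((n : ℝ) / 2) + 1) * η' :=
      mul_le_mul_of_nonneg_right (by linarith) hη'0.le
    have h2 : (3 / Real.sqrt 6 * ((n : ℝ) / 2) + 1) * η' = min (η / 2) (1 / 10) := by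
      rw [hη']; field_simp
    linarith [min_le_left (η / 2) (1 / 10)]
  have e : ((n : ℝ) / 2) ^ 2 - 3 / Real.sqrt 6 * ((n : ℝ) / 2) * (Wb + η') -
      Real.log (n + 1) / ((2 + r) * β) - 3 * (C + β * η / 3) / (2 * β) =
      ((n : ℝ) / 2) ^ 2 - (n : ℝ) / 2 * (3 / Real.sqrt 6 * Wb) -
        Real.log (n + 1) / ((2 + r) * β) - 3 * C / (2 * β) -
        3 / Real.sqrt 6 * ((n : ℝ) / 2) * η' - η / 2 := by
    field_simp
    ring
  nlinarith [h, e, hcost, mul_le_mul_of_nonneg_left hd hS0]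

/-- **Néel long-range order of the layered spin-`S` antiferromagnet at positive temperature for
EVERY spin `S ≥ 1` and EVERY interlayer ratio `0 < r ≤ 1`**: for all inverse temperatures `β`
with `2β·S(S - 0.9464) > 2log(n+1)/(2+r) + 3(3 + log(1/r))`, the floor
`S(S - 0.9464) - log(n+1)/((2+r)β) - 3(3 + log(1/r))/(2β)` is positive and bounds the thermal
staggered order parameter from below (`klsConstant_le`: `C(r) ≤ 3 + log(1/r)`). In units of the
in-plane exchange `J∥` (`J⊥ = rJ∥ ≤ J∥`): the layered spin-`S ≥ 1` Heisenberg antiferromagnet is Néel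
ordered for all `k_BT < 2J∥S(S - 0.9464)/(2log(2S+1)/(2+r) + 9 + 3log(J∥/J⊥))`.
[cite: KLS1988JSP, p. 1020, §3, eq. (5)] [cite: DLS1978, Thm. 6.2] [cite: FILS1978, eq. (4.7), Thm. 4.7] -/
theorem layeredHeis_neelLRO_thermal_spinOne_all (hr0 : 0 < r) (hr1 : r ≤ 1) {n : ℕ} (hn : 2 ≤ n)
    {β : ℝ} (hβ : 0 < β)
    (hβT : 2 * Real.log (n + 1) / (2 + r) + 3 * (3 + Real.log (1 / r)) <
      2 * β * ((n : ℝ) / 2 * ((n : ℝ) / 2 - 0.9464))) :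
    0 < (n : ℝ) / 2 * ((n : ℝ) / 2 - 0.9464) - Real.log (n + 1) / ((2 + r) * β) -
        3 * (3 + Real.log (1 / r)) / (2 * β) ∧
      (n : ℝ) / 2 * ((n : ℝ) / 2 - 0.9464) - Real.log (n + 1) / ((2 + r) * β) -
          3 * (3 + Real.log (1 / r)) / (2 * β) ≤
        liminf (fun k : ℕ =>
          (∑ x : TorusSite 3 (2 * k + 2), ∑ y : TorusSite 3 (2 * k + 2),
            (-1 : ℝ) ^ (∑ i, (x i).val) * (-1) ^ (∑ i, (y i).val) *
              ∑ α : Fin 3, gibbsSpinCorr β (heisAnisoTorus (2 * k + 2) n ![(1 : ℝ), 1, r]) α x y) /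
            ((2 * k + 2 : ℕ) : ℝ) ^ (2 * 3)) atTop := by
  have hS : (1 : ℝ) ≤ (n : ℝ) / 2 := by
    have : (2 : ℝ) ≤ n := by exact_mod_cast hn
    linarith
  have hS0 : (0 : ℝ) ≤ (n : ℝ) / 2 := by linarith
  have h := layeredHeis_thermalNeelOrderParameter_ge_spinOne hr0 hr1 hn hβ
  have hCle := AnisotropicRotator.klsConstant_le hr0 hr1
  have hdiv : 3 * AnisotropicRotator.klsConstant r / (2 * β) ≤
      3 * (3 + Real.log (1 / r)) / (2 * β) :=
    div_le_div_of_nonneg_right (by linarith) (by positivity)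
  have h2r : 0 < 2 + r := by linarith
  constructor
  · have e : (n : ℝ) / 2 * ((n : ℝ) / 2 - 0.9464) - Real.log (n + 1) / ((2 + r) * β) -
        3 * (3 + Real.log (1 / r)) / (2 * β) =
        (2 * β * ((n : ℝ) / 2 * ((n : ℝ) / 2 - 0.9464)) -
          (2 * Real.log (n + 1) / (2 + r) + 3 * (3 + Real.log (1 / r)))) / (2 * β) := by
      field_simp
      ring
    rw [e]
    exact div_pos (by linarith) (by positivity)
  · refine le_trans ?_ h
    nlinarith [mul_le_mul_of_nonneg_left hr1 hS0]

/-- **The thermal floor with the sharp interlayer logarithm** (`klsConstant_le_sharp`: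
`C(r) ≤ 1 + π/4 + (π/8)log(1/r)`): for `0 < r ≤ 1`, `S = n/2 ≥ 1`, `β > 0`,
`liminf |Λ|⁻² Σ_{x,y}(-1)^{x+y}⟨𝐒_x·𝐒_y⟩_β ≥
S(S - 0.7959 - 0.1505r) - log(n+1)/((2+r)β) - 3(1 + π/4 + (π/8)log(1/r))/(2β)`.
[cite: KLS1988JSP, p. 1020, eqs. (5), (7)] [cite: DLS1978, Thm. 6.2] [cite: FILS1978, eq. (4.7)] -/
theorem layeredHeis_thermalNeelOrderParameter_ge_spinOne_sharp (hr0 : 0 < r) (hr1 : r ≤ 1) {n : ℕ}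
    (hn : 2 ≤ n) {β : ℝ} (hβ : 0 < β) :
    (n : ℝ) / 2 * ((n : ℝ) / 2 - 0.7959 - 0.1505 * r) - Real.log (n + 1) / ((2 + r) * β) -
        3 * (1 + Real.pi / 4 + Real.pi / 8 * Real.log (1 / r)) / (2 * β) ≤
      liminf (fun k : ℕ =>
        (∑ x : TorusSite 3 (2 * k + 2), ∑ y : TorusSite 3 (2 * k + 2),
          (-1 : ℝ) ^ (∑ i, (x i).val) * (-1) ^ (∑ i, (y i).val) *
            ∑ α : Fin 3, gibbsSpinCorr β (heisAnisoTorus (2 * k + 2) n ![(1 : ℝ), 1, r]) α x y) /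
          ((2 * k + 2 : ℕ) : ℝ) ^ (2 * 3)) atTop := by
  have h := layeredHeis_thermalNeelOrderParameter_ge_spinOne hr0 hr1 hn hβ
  have hCle := AnisotropicRotator.klsConstant_le_sharp hr0 hr1
  have hdiv : 3 * AnisotropicRotator.klsConstant r / (2 * β) ≤
      3 * (1 + Real.pi / 4 + Real.pi / 8 * Real.log (1 / r)) / (2 * β) :=
    div_le_div_of_nonneg_right (by linarith) (by positivity)
  linarith

/-- **Néel order at positive temperature, every spin `S ≥ 1`, every `0 < r ≤ 1`, with the sharp
interlayer logarithm**: LRO for all `β` with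
`2β·S(S - 0.9464) > 2log(n+1)/(2+r) + 3(1 + π/4 + (π/8)log(1/r))`, i.e. in units of `J∥`
(`J⊥ = rJ∥`): Néel order of the layered spin-`S` antiferromagnet for all
`k_BT < 2J∥S(S - 0.9464)/(2log(2S+1)/(2+r) + 3 + 3π/4 + (3π/8)log(J∥/J⊥))`
(`3 + 3π/4 = 5.356…`, `3π/8 = 1.178…`). [cite: KLS1988JSP, p. 1020, §3, eq. (5)]
[cite: DLS1978, Thm. 6.2] [cite: FILS1978, eq. (4.7), Thm. 4.7] -/
theorem layeredHeis_neelLRO_thermal_spinOne_all_sharp (hr0 : 0 < r) (hr1 : r ≤ 1) {n : ℕ}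
    (hn : 2 ≤ n) {β : ℝ} (hβ : 0 < β)
    (hβT : 2 * Real.log (n + 1) / (2 + r) + 3 * (1 + Real.pi / 4 + Real.pi / 8 * Real.log (1 / r)) <
      2 * β * ((n : ℝ) / 2 * ((n : ℝ) / 2 - 0.9464))) :
    0 < (n : ℝ) / 2 * ((n : ℝ) / 2 - 0.9464) - Real.log (n + 1) / ((2 + r) * β) -
        3 * (1 + Real.pi / 4 + Real.pi / 8 * Real.log (1 / r)) / (2 * β) ∧
      (n : ℝ) / 2 * ((n : ℝ) / 2 - 0.9464) - Real.log (n + 1) / ((2 + r) * β) -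
          3 * (1 + Real.pi / 4 + Real.pi / 8 * Real.log (1 / r)) / (2 * β) ≤
        liminf (fun k : ℕ =>
          (∑ x : TorusSite 3 (2 * k + 2), ∑ y : TorusSite 3 (2 * k + 2),
            (-1 : ℝ) ^ (∑ i, (x i).val) * (-1) ^ (∑ i, (y i).val) *
              ∑ α : Fin 3, gibbsSpinCorr β (heisAnisoTorus (2 * k + 2) n ![(1 : ℝ), 1, r]) α x y) /
            ((2 * k + 2 : ℕ) : ℝ) ^ (2 * 3)) atTop := by
  have hS : (1 : ℝ) ≤ (n : ℝ) / 2 := by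
    have : (2 : ℝ) ≤ n := by exact_mod_cast hn
    linarith
  have hS0 : (0 : ℝ) ≤ (n : ℝ) / 2 := by linarith
  have h := layeredHeis_thermalNeelOrderParameter_ge_spinOne_sharp hr0 hr1 hn hβ
  have h2r : 0 < 2 + r := by linarith
  constructor
  · have e : (n : ℝ) / 2 * ((n : ℝ) / 2 - 0.9464) - Real.log (n + 1) / ((2 + r) * β) -
        3 * (1 + Real.pi / 4 + Real.pi / 8 * Real.log (1 / r)) / (2 * β) =
        (2 * β * ((n : ℝ) / 2 * ((n : ℝ) / 2 - 0.9464)) -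
          (2 * Real.log (n + 1) / (2 + r) +
            3 * (1 + Real.pi / 4 + Real.pi / 8 * Real.log (1 / r)))) / (2 * β) := by
      field_simp
      ring
    rw [e]
    exact div_pos (by linarith) (by positivity)
  · refine le_trans ?_ h
    nlinarith [mul_le_mul_of_nonneg_left hr1 hS0]

end Thermal

end Literature.MathematicalPhysics.QuantumLattice
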